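/-
Copyright (c) 2026 the pub-hodgecm-mathlib formalisation cell (harness21).  Prover seat hodgecm-mathlib-K2E3-p06 (g3), Track B «K2-LIT» ∕ h413, road J ∕ R3 (d)
brick (d-w-0) «exact Euler–Poincaré indices at a ramified place», FILE B2: the tree of `SL₂(F)` is `(q+1)`-regular.  2026-09-04.
-/
import Literature.NumberTheory.Automorphic.IwahoriGLTwoIndex                      -- ★ FILE B1 (this seat): `relIndex_iwahoriGL_two_glInt` (`[GL₂(𝒪) : I] = q + 1`), `mem_iwahoriGL_two_iff`
import Literature.NumberTheory.Automorphic.UnitaryTwoRamifiedTreeStabilizers          -- ★ (F0P3a-p04): `glVertexAct_next_eq_next_iff`, `coe_glDiagonal_one_two` (the `GL₂`-level stabiliser dictionary)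
import Literature.NumberTheory.Automorphic.SLTwoTreeTransitive                       -- ★ (B-p08): `forall_isModularLattice_rootStar_exists_latt_mul_eq_id_altJ`, `latticeTree_adj_root`, `exists_glVertexAct_eq`
import Literature.NumberTheory.Automorphic.SLTwoTreeProjectiveActionIso              -- ★ (B-p08): `glTreeIso`, `latticeTree_adj_glVertexAct`
import Literature.NumberTheory.Automorphic.SLTwoTreeQuadraticTorusShellDecomposition -- ★ (A-p17): `glVertexAct_root_eq_of_mem_glInt`
import Literature.NumberTheory.Automorphic.HermitianLatticeTreeFrames                -- ★ (A-p17): `not_isModularLattice_of_isSelfDualLattice`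
import Literature.Combinatorics.SimpleGraph.DartTransitiveStabilizerIndex            -- ★ FILE A (this seat): `index_edgeStab_eq_ncard_neighborSet_of_forall_eq`
import HarnessLib

/-!
# The tree of `SL₂(F)` is `(q + 1)`-regular (Serre, *Trees* II.1.1 Theorem 1 and Cor.; Iwahori–Matsumoto 1965 §2)

Topic `NumberTheory/Automorphic`; namespace `Literature.NumberTheory.Automorphic.HermitianLatticeTree` (that of ★ `SLTwoTreeAsLatticeTree` ∕ ★ `SLTwoTreeTransitive`).
THEOREMS ONLY (no definition, no instance, no notation, no named fact, no `sorry`); count-neutral helper `--supports stmt-HodgeConjecture-24833`.  Cell `pub/hodgecm-mathlib`,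
crux H413, Track B «K2-LIT», unit U3b, road J letter ‹J3›, place class (d-w), brick (d-w-0) FILE B2 (dealer K2E3-plan (g2) 2026-09-04T01:34:25Z (D16)).
For a field `F` carrying Mathlib's `Valued F ℤᵐ⁰` compatible with its `ValuativeRel` (the tree's currency for `L⁺_v`), a uniformiser `v ϖ = exp (−1)` and a FINITE residue
field of cardinality `q`: every vertex of the lattice tree `X = latticeTree (RingHom.id F) ϖ (0 1; −1 0)` of `SL₂(F)` (★ `SLTwoTreeAsLatticeTree`) has exactly `q + 1`
neighbours — ANY residue characteristic, no `|2|` hypothesis.  This is the count behind Kottwitz's Euler–Poincaré index `[K_vertex : I] = q + 1` of `U(1,1)(L⁺_v)` at a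
RAMIFIED place (FILE C reads it through ★ `rhoVertexActPlace` and ★ FILE A).
HONEST LABEL: HC_CM is proved only modulo the 7 printed citations (2 remaining named inputs: hLiu418 = stmt-HodgeConjecture-24832, h413 = stmt-HodgeConjecture-24833) until rung 0
closes; elementary lattice bookkeeping, nothing printed is asserted.

THE COUNT.  `v₀ = 𝒪² = latt 1`, `v₁ = 𝒪 ⊕ ϖ𝒪 = latt diag(1, ϖ)`, `v₀ ~ v₁` (★ `latticeTree_adj_root`).  (§1) For `k ∈ GL₂(𝒪)`: `k·v₁ = v₁ ⟺ k ∈ I` (the Iwahori subgroup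
`|k₂₁| < 1`; ★ `glVertexAct_next_eq_next_iff`, the homothety exponent being `0` by determinants).  (§2) `GL₂(𝒪)` fixes `v₀` (★ `glVertexAct_root_eq_of_mem_glInt`) and is
transitive on the star of `v₀` (★ root-star transitivity `forall_isModularLattice_rootStar_exists_latt_mul_eq_id_altJ`), so by the orbit–stabiliser lemma ★
`index_edgeStab_eq_ncard_neighborSet_of_forall_eq` (FILE A) `#star(v₀) = [GL₂(𝒪) : I] = q + 1` (★ FILE B1).  (§3) `GL₂(F)` is transitive on vertices (★ `exists_glVertexAct_eq`)
by graph automorphisms (★ `glTreeIso`), so EVERY star has `q + 1` elements.  [Serre1980Trees, II.1.1 Thm. 1 & Cor.; IwahoriMatsumoto1965 §2.]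

## References
* [Serre1980Trees] J.-P. Serre, *Trees* (1980), Ch. II §1.1 Theorem 1 and its Corollary (the `q + 1` neighbours), §1.2–§1.3.
* [IwahoriMatsumoto1965] N. Iwahori, H. Matsumoto, Publ. IHÉS 25 (1965), §2 Prop. 2.4.
* [Kottwitz1988] R. E. Kottwitz, *Tamagawa numbers*, Ann. of Math. 127 (1988), §2 (the levels of the Euler–Poincaré function).
-/

set_option autoImplicit false

noncomputable section

open scoped ValuativeRel Matrix MatrixGroups WithZero
open Matrix ValuativeRel

namespace Literature.NumberTheory.Automorphic.HermitianLatticeTree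

open Literature.NumberTheory.Automorphic Literature.NumberTheory.Automorphic.UnitaryGroup Literature.Combinatorics.SimpleGraph

section Valued

variable {F : Type*} [Field F] [Valued F ℤᵐ⁰] [ValuativeRel F] [(Valued.v : Valuation F ℤᵐ⁰).Compatible] {ϖ : F}
  (hϖ : Valued.v ϖ = WithZero.exp (-1 : ℤ))
  (v₀ v₁ : {M : Submodule 𝒪[F] (Fin 2 → F) // IsSpecialLattice (RingHom.id F) ϖ !![(0 : F), 1; -1, 0] M})
  (hv₀ : v₀.1 = latt (1 : Matrix (Fin 2) (Fin 2) F)) (hv₁ : v₁.1 = latt (Matrix.diagonal ![(1 : F), ϖ]))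

/-! ## §1 The stabiliser of `v₁ = 𝒪 ⊕ ϖ𝒪` in `GL₂(𝒪)` is the Iwahori subgroup -/

include hϖ hv₁ in
/-- **For `k ∈ GL₂(𝒪)`: `k · v₁ = v₁ ⟺ k ∈ I`** (`I` the Iwahori subgroup, `|k₂₁| < 1`): `k·(𝒪 ⊕ ϖ𝒪) = 𝒪 ⊕ ϖ𝒪` iff `diag(1,ϖ)⁻¹ k diag(1,ϖ)` is integral iff `k₂₁ ∈ ϖ𝒪`
(★ `glVertexAct_next_eq_next_iff`; the homothety exponent is `0` by determinants). [cite: Serre1980Trees, Ch. II §1.1] [cite: IwahoriMatsumoto1965, §2 Prop. 2.4] -/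
theorem glVertexAct_next_eq_next_iff_mem_iwahoriGL [IsDiscreteValuationRing 𝒪[F]] {k : GL (Fin 2) F} (hk : k ∈ glInt 2 F) :
    glVertexAct (isUniformizingElement_of_v_eq hϖ) k v₁ = v₁ ↔ k ∈ iwahoriGL 2 F := by
  have hϖ0 : ϖ ≠ 0 := (isUniformizingElement_of_v_eq hϖ).ne_zero
  have hvϖ0 : Valued.v ϖ ≠ 0 := (Valuation.ne_zero_iff _).2 hϖ0
  have hkij : ∀ i j, Valued.v ((k : Matrix (Fin 2) (Fin 2) F) i j) ≤ 1 := ((mem_glInt_iff_forall_v_le_one_and_v_det_eq_one k).1 hk).1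
  have hkdet : Valued.v (k : Matrix (Fin 2) (Fin 2) F).det = 1 := ((mem_glInt_iff_forall_v_le_one_and_v_det_eq_one k).1 hk).2
  -- the entries of `diag(1,ϖ⁻¹) (ϖ^m k) diag(1,ϖ)`
  have hent : ∀ (m : ℤ) (i j : Fin 2), (diagonal ![(1 : F), ϖ⁻¹] * (ϖ ^ m • (k : Matrix (Fin 2) (Fin 2) F)) * diagonal ![(1 : F), ϖ]) i j =
      ![(1 : F), ϖ⁻¹] i * (ϖ ^ m * (k : Matrix (Fin 2) (Fin 2) F) i j) * ![(1 : F), ϖ] j := by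
    intro m i j
    rw [Matrix.mul_diagonal, Matrix.diagonal_mul, Matrix.smul_apply, smul_eq_mul]
  have hdet : ∀ m : ℤ, Valued.v (diagonal ![(1 : F), ϖ⁻¹] * (ϖ ^ m • (k : Matrix (Fin 2) (Fin 2) F)) * diagonal ![(1 : F), ϖ]).det =
      WithZero.exp (-(2 * m)) := by
    intro m
    rw [det_mul, det_mul, det_diagonal, det_diagonal, det_smul, Fintype.card_fin, Fin.prod_univ_two, Fin.prod_univ_two]
    simp only [Matrix.cons_val_zero, Matrix.cons_val_one, Matrix.cons_val_fin_one, one_mul]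
    rw [map_mul, map_mul, map_mul, map_inv₀, map_pow, map_zpow₀, hkdet, hϖ, mul_one, ← WithZero.exp_zsmul, ← WithZero.exp_nsmul, ← WithZero.exp_neg,
      ← WithZero.exp_add, ← WithZero.exp_add]
    congr 1
    simp only [smul_eq_mul, nsmul_eq_mul]
    ring
  rw [glVertexAct_next_eq_next_iff (isUniformizingElement_of_v_eq hϖ) k v₁ hv₁, mem_iwahoriGL_two_iff, ← v_lt_one_iff_valuation_lt_one]
  constructor
  · rintro ⟨m, hle, hd⟩
    rw [hdet, ← WithZero.exp_zero, WithZero.exp_inj] at hd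
    have hm : m = 0 := by omega
    subst hm
    refine ⟨hk, ?_⟩
    have h10 := hle 1 0
    rw [hent, zpow_zero, one_mul] at h10
    simp only [Matrix.cons_val_one, Matrix.cons_val_fin_one, Matrix.cons_val_zero, mul_one, map_mul, map_inv₀, hϖ] at h10
    -- `h10 : (exp (-1))⁻¹ * v k₁₀ ≤ 1`
    by_cases h0 : (k : Matrix (Fin 2) (Fin 2) F) 1 0 = 0
    · rw [h0, map_zero]; exact zero_lt_one
    · have hv0 : Valued.v ((k : Matrix (Fin 2) (Fin 2) F) 1 0) ≠ 0 := (Valuation.ne_zero_iff _).2 h0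
      rw [← WithZero.exp_log hv0] at h10 ⊢
      rw [← WithZero.exp_neg, ← WithZero.exp_add, ← WithZero.exp_zero, WithZero.exp_le_exp] at h10
      rw [← WithZero.exp_zero, WithZero.exp_lt_exp]
      omega
  · rintro ⟨-, hlt⟩
    refine ⟨0, fun i j => ?_, by rw [hdet, mul_zero, neg_zero, WithZero.exp_zero]⟩
    rw [hent, zpow_zero, one_mul]
    fin_cases i <;> fin_cases j
    · simpa using hkij 0 0
    · simp only [Fin.zero_eta, Fin.isValue, Fin.mk_one, Matrix.cons_val_zero, Matrix.cons_val_one, Matrix.cons_val_fin_one, one_mul, map_mul, hϖ]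
      calc Valued.v ((k : Matrix (Fin 2) (Fin 2) F) 0 1) * WithZero.exp (-1 : ℤ) ≤ 1 * 1 :=
            mul_le_mul' (hkij 0 1) (by rw [← WithZero.exp_zero, WithZero.exp_le_exp]; norm_num)
        _ = 1 := one_mul 1
    · simp only [Fin.mk_one, Fin.isValue, Fin.zero_eta, Matrix.cons_val_one, Matrix.cons_val_fin_one, Matrix.cons_val_zero, mul_one, map_mul, map_inv₀, hϖ]
      -- `(exp (-1))⁻¹ * v k₁₀ ≤ 1` from `v k₁₀ < 1`
      by_cases h0 : (k : Matrix (Fin 2) (Fin 2) F) 1 0 = 0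
      · rw [h0, map_zero, mul_zero]; exact zero_le_one
      · have hv0 : Valued.v ((k : Matrix (Fin 2) (Fin 2) F) 1 0) ≠ 0 := (Valuation.ne_zero_iff _).2 h0
        rw [← WithZero.exp_log hv0] at hlt ⊢
        rw [← WithZero.exp_zero, WithZero.exp_lt_exp] at hlt
        rw [← WithZero.exp_neg, ← WithZero.exp_add, ← WithZero.exp_zero, WithZero.exp_le_exp]
        omega
    · simp only [Fin.mk_one, Fin.isValue, Matrix.cons_val_one, Matrix.cons_val_fin_one, map_mul, map_inv₀]
      rw [mul_comm (Valued.v ϖ)⁻¹, mul_assoc, inv_mul_cancel₀ hvϖ0, mul_one]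
      exact hkij 1 1

/-! ## §2 The star of the root has `q + 1` elements -/

include hϖ hv₀ hv₁ in
/-- **`#star(𝒪²) = q + 1`**: the neighbours of the root `v₀ = 𝒪²` of the tree of `SL₂(F)` are the `GL₂(𝒪)`-orbit of `v₁ = 𝒪 ⊕ ϖ𝒪` (★ root-star transitivity), `GL₂(𝒪)`
fixes `v₀`, and the stabiliser of `v₁` in `GL₂(𝒪)` is the Iwahori subgroup (§1), of index `q + 1` (★ FILE B1) — orbit–stabiliser (★ FILE A).
[cite: Serre1980Trees, Ch. II §1.1 Theorem 1 and Cor.] [cite: IwahoriMatsumoto1965, §2 Prop. 2.4] -/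
theorem ncard_neighborSet_root [Finite 𝓀[F]] :
    ((latticeTree (RingHom.id F) ϖ !![(0 : F), 1; -1, 0]).neighborSet v₀).ncard = Nat.card 𝓀[F] + 1 := by
  haveI : IsDiscreteValuationRing 𝒪[F] := isDiscreteValuationRing_integer_of_compatible hϖ
  have hϖ' := isUniformizingElement_of_v_eq hϖ
  have hϖ0 : ϖ ≠ 0 := hϖ'.ne_zero
  -- the reference element `g₁ = diag(1, ϖ)` of `GL₂(F)`
  have hg₁ : ((glDiagonal 2 F ![1, Units.mk0 ϖ hϖ0] : GL (Fin 2) F) : Matrix (Fin 2) (Fin 2) F) = Matrix.diagonal ![(1 : F), ϖ] := by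
    rw [coe_glDiagonal_one_two, Units.val_mk0]
  have hfix : ∀ k : ↥(glInt 2 F), glVertexAct hϖ' (k : GL (Fin 2) F) v₀ = v₀ := fun k => glVertexAct_root_eq_of_mem_glInt hϖ' k.2 v₀ hv₀
  have key := index_edgeStab_eq_ncard_neighborSet_of_forall_eq (latticeTree (RingHom.id F) ϖ !![(0 : F), 1; -1, 0])
    (fun (k : ↥(glInt 2 F)) x => glVertexAct hϖ' (k : GL (Fin 2) F) x)
    (fun x => by simp only [Subgroup.coe_one]; exact glVertexAct_one hϖ' x)
    (fun g h x => by simp only [Subgroup.coe_mul]; exact glVertexAct_mul hϖ' _ _ x)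
    (fun g x y hxy => latticeTree_adj_glVertexAct hϖ' _ hxy)
    (latticeTree_adj_root hϖ' v₀ v₁ hv₀ hv₁) ?_ ((iwahoriGL 2 F).subgroupOf (glInt 2 F)) ?_ hfix
  · rw [← key]
    exact relIndex_iwahoriGL_two_glInt F
  · -- star-transitivity of `GL₂(𝒪)` at the root
    intro b hb
    rw [latticeTree_adj_iff] at hb
    obtain ⟨-, hb⟩ := hb
    have hsd0 : IsSelfDualLattice (RingHom.id F) !![(0 : F), 1; -1, 0] v₀.1 :=
      (isSelfDualLattice_id_altJ_iff _).2 ⟨1, by rw [hv₀, Units.val_one], by rw [Units.val_one, det_one, map_one]⟩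
    rcases hb with ⟨-, hmod, h1, h2⟩ | ⟨-, hmod0, -, -⟩
    · rw [hv₀] at h1 h2
      obtain ⟨k, hkK, hk⟩ := forall_isModularLattice_rootStar_exists_latt_mul_eq_id_altJ hϖ' _ hg₁ b.1 hmod h1 h2
      refine ⟨⟨(k : GL (Fin 2) F), hkK⟩, hfix ⟨_, hkK⟩, ?_⟩
      refine (glVertexAct_eq_iff hϖ' _ v₁ b).2 ⟨0, ?_⟩
      rw [zpow_zero, scaleLattice_one, hv₁, ← hg₁, mapGL_latt, hk]
    · exact (not_isModularLattice_of_isSelfDualLattice (RingHom.id F) (fun _ => rfl) hϖ' _ hsd0 hmod0).elim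
  · -- the edge stabiliser is the Iwahori subgroup
    intro k
    rw [Subgroup.mem_subgroupOf, hfix k, Sym2.congr_right]
    exact (glVertexAct_next_eq_next_iff_mem_iwahoriGL hϖ v₁ hv₁ k.2).symm

/-! ## §3 Every star has `q + 1` elements -/

include hϖ hv₀ hv₁ in
/-- **THE TREE OF `SL₂(F)` IS `(q+1)`-REGULAR**: every vertex has exactly `q + 1` neighbours (`GL₂(F)` is transitive on vertices, ★ `exists_glVertexAct_eq`, acting by graph
automorphisms, ★ `glTreeIso`; and `#star(𝒪²) = q + 1`, §2). [cite: Serre1980Trees, Ch. II §1.1 Theorem 1 and Cor.] -/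
theorem ncard_neighborSet_eq [Finite 𝓀[F]] (N : {M : Submodule 𝒪[F] (Fin 2 → F) // IsSpecialLattice (RingHom.id F) ϖ !![(0 : F), 1; -1, 0] M}) :
    ((latticeTree (RingHom.id F) ϖ !![(0 : F), 1; -1, 0]).neighborSet N).ncard = Nat.card 𝓀[F] + 1 := by
  haveI : IsDiscreteValuationRing 𝒪[F] := isDiscreteValuationRing_integer_of_compatible hϖ
  have hϖ' := isUniformizingElement_of_v_eq hϖ
  obtain ⟨g, hg⟩ := exists_glVertexAct_eq hϖ' v₀ hv₀ N
  have e := (glTreeIso hϖ' g).mapNeighborSet v₀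
  rw [glTreeIso_apply, hg] at e
  rw [← ncard_neighborSet_root hϖ v₀ v₁ hv₀ hv₁, ← Nat.card_coe_set_eq, ← Nat.card_coe_set_eq]
  exact (Nat.card_congr e).symm

end Valued

end Literature.NumberTheory.Automorphic.HermitianLatticeTree

end
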